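import Summits.ABC.StewartYu.PadicG3TwoThirdReindexR
import Summits.ABC.StewartYu.PadicG3TwoThirdStep
import HarnessLib

/-!
# Cell abc-stewartyu, Gen-3 frame at `p = 2` (crux `Y07Two`, stmt-ABC-19659), layer F5 brick (7) v2: the THIRD STEP
# PACKAGED on the BASE-RELATIVE re-indexing — `ThirdStepTwo σ Sh I` from `ThirdFinalTwoR`, `BasisStepTwoR`, `3`-Kummer

`Summits/ABC/StewartYu/PadicG3TwoThirdStepR.lean` — cell `abc-stewartyu` (HOME `run/shared/lean/pub/abc-stewartyu/`),
route `PadicPrimesKummerThird`, seat p5 (g3); v2 of `PadicG3TwoThirdStep.lean` after the record flag of p1-g7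
(2026-08-27T02:31Z, see `PadicG3TwoThirdReindexR`).  Two `Prop`-structures and theorems; no named fact.

DIFFERENCES TO v1: the new family is `Λ.reindex3R i₁` (exponents relative to the base unknown `i₁` of the class,
`κ′ = (κ − κ_{i₁})/3`); the exponent BOX of the new level is no longer derived from the old box by `(D+2)/3` (which
floors at `1`) but is an obligation of the ASSEMBLER (`BasisStepTwoR.box`), who knows that the level-`I` exponents are
`(λ − λ♭)/3^I` for points `λ` of the original box and hence bounded by `2·side/3^I` (Nesterenko (4.35)); accordingly
`ThirdFinalTwoR` drops `Dbox_succ`/`Dθ_succ`.  Everything else (smallness at the third points, Liouville with the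
sizes of `PadicG3TwoThirdSizes`, slab re-based at `i₁`, weights transported, `Y₀`-weights from the next level's data)
is as in v1.  Result: **`thirdStepTwo_ofR`**.

WHAT THIS IS NOT: no numbers, no basis facts; no crux moves.

References: K. Yu, Acta Math. 211 (2013), Lemmas 5.3–5.4, (5.1)(i); Yu. V. Nesterenko, LNM 1819 (2003), §4.3 (4.35).
-/

noncomputable section

open Finset Polynomial
open Literature.NumberTheory.Transcendental
open Literature.NumberTheory.Transcendental.CW77 (heightProd)
open Literature.NumberTheory.Transcendental.CW77.Setup (Tau tauNorm)
open Literature.NumberTheory.Transcendental.PadicCW77 (condExp)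

namespace Summit.ABC.StewartYu

namespace TwoSetup

variable {S : TwoSetup} {ι : Type*} (σ : S.G3TwoSched) (Sh : ℕ → S.G3Fam ι → Prop)

/-! ### The record's and the assembler's obligations (v2) -/

/-- **THE RECORD'S OBLIGATIONS FOR THE THIRD STEP `I → I + 1` (v2)**: as `ThirdFinalTwo` without the box
recursion (the new box is the assembler's, `BasisStepTwoR.box`). [cite: Yu2013, Lemma 5.4 (5.58)–(5.70); shape only] -/
structure ThirdFinalTwoR (I : ℕ) : Prop where
  /-- the multiplicity spent at the third points -/
  tthird_pos : 1 ≤ σ.Tfin I - σ.T0 (I + 1)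
  /-- order budget -/
  T0_succ_le : σ.T0 (I + 1) ≤ σ.Tfin I
  /-- family size slot is monotone -/
  cardB_mono : σ.cardB I ≤ σ.cardB (I + 1)
  /-- weighted coefficient slot is monotone -/
  Bw_mono : σ.Bw I ≤ σ.Bw (I + 1)
  /-- the new directional bound -/
  Xb_succ : ∀ j, |S.bθ| * (σ.Dbox (I + 1) j : ℤ) + |S.b j| * (σ.Dθ (I + 1) : ℤ) ≤ σ.Xb (I + 1)
  /-- positive `Y₀`-weight denominators at the next level -/
  one_le_den₀ : ∀ (x : ℤ) (τ : Tau S.d), 1 ≤ σ.den₀ (I + 1) x τ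
  /-- the third-step inequality at every new node -/
  hfinal : ∀ s : ℤ, |s| ≤ (σ.N0 (I + 1) : ℤ) → ¬ (3 : ℤ) ∣ s → ∀ τ : Tau S.d, tauNorm τ < σ.T0 (I + 1) →
    max (σ.Bw I * ‖S.Λ₀‖ * (2 : ℝ) ^ (σ.Tfin I - σ.T0 (I + 1)) *
          (2 : ℝ) ^ condExp 2 (2 * σ.Nfin I + 1) (σ.Tfin I - σ.T0 (I + 1)))
        (σ.Bw I / (4 * (2 : ℝ) ^ σ.m) ^ ((2 * σ.Nfin I + 1) * (σ.Tfin I - σ.T0 (I + 1)))) <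
      1 / (6 * (thirdDen σ I s τ : ℝ) * thirdM σ I s τ * heightProd S.toQ.all ^ 5) ^ (3 ^ (S.d + 1 + 1) - 1)

/-- **THE ASSEMBLER'S BASIS STEP `I → I + 1` (v2)**: the rescaled basis' `Y₀`-weight data at the integers, the
EXPONENT BOX of every base-relative re-indexed class (from the shape's common base point: `κ⁽ᴵ⁾ = (λ − λ♭)/3^I`,
`λ` in the original box), and the shape predicate for every such class.
[cite: Nesterenko2003, §3.1, §4.3 (4.35) and (4.20); shape only] -/
structure BasisStepTwoR (I : ℕ) : Prop where
  /-- `Y₀`-weights of the rescaled basis at the integers -/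
  hasse : ∀ Λ : S.G3Fam ι, S.G3Adm σ Sh I Λ → ∀ i ∈ Λ.B, ∀ (x : ℤ) (τ : Tau S.d), ∃ z₀ : ℤ,
    (σ.den₀ (I + 1) x τ : ℚ) * (hasseDeriv τ.1 ((Λ.R i).comp (C (3⁻¹ : ℚ) * X))).eval (x : ℚ) = z₀ ∧
      |z₀| ≤ σ.M₀ (I + 1) x τ
  /-- the exponent box of the base-relative re-indexed class -/
  box : ∀ Λ : S.G3Fam ι, S.G3Adm σ Sh I Λ → ∀ i₁ ∈ Λ.B, ∀ i ∈ (Λ.reindex3R i₁).B,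
    (∀ j, |(Λ.reindex3R i₁).u i j| ≤ (σ.Dbox (I + 1) j : ℤ)) ∧ |(Λ.reindex3R i₁).uθ i| ≤ (σ.Dθ (I + 1) : ℤ)
  /-- the shape predicate passes to every base-relative re-indexed class -/
  shape : ∀ Λ : S.G3Fam ι, S.G3Adm σ Sh I Λ → ∀ i₁ ∈ Λ.B, Sh (I + 1) (Λ.reindex3R i₁)

/-! ### The class sums vanish at the new nodes -/

/-- **All triadic class sums vanish** at `|s| ≤ N0 (I+1)`, `3 ∤ s`, `|τ| < T0 (I+1)` (v2 structures).
[cite: Yu2013, Lemmas 5.3–5.4] -/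
theorem thirdVec_eq_zero_of_admR {I : ℕ} (hfin : ThirdFinalTwoR σ I) (hbs : BasisStepTwoR σ Sh I)
    (hK : ∀ κ : Fin (S.d + 1) → ℕ, (∃ j, ¬ 3 ∣ κ j) → ∀ γ : ℚ, ∏ j, S.toQ.all j ^ κ j ≠ γ ^ 3)
    {Λ : S.G3Fam ι} (hadm : S.G3Adm σ Sh I Λ) (hvan : Λ.vanish nodesAll (σ.Nfin I) (σ.Tfin I)) :
    ∀ s : ℤ, |s| ≤ (σ.N0 (I + 1) : ℤ) → ¬ (3 : ℤ) ∣ s → ∀ τ : Tau S.d, tauNorm τ < σ.T0 (I + 1) →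
      S.thirdVec Λ.R Λ.u Λ.uθ Λ.B Λ.p τ s = 0 := by
  intro s hs h3 τ hτ
  obtain ⟨i, hi, _⟩ := hadm.exists_ne
  have hBw0 : 0 ≤ σ.Bw I := by
    have h := hadm.wt i hi 0 0
    rw [pow_zero, mul_one] at h
    exact (norm_nonneg _).trans h
  -- third-point weight data from the next level's data for `R ∘ (Y₀/3)`
  have hR3 : ∀ i ∈ Λ.B, ∃ z₀ : ℤ, (σ.den₀ (I + 1) s τ : ℚ) * (hasseDeriv τ.1 (Λ.R i)).eval ((s : ℚ) / 3) = z₀ ∧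
      |z₀| ≤ 3 ^ τ.1 * σ.M₀ (I + 1) s τ := by
    intro i hi
    obtain ⟨z₀, hz₀, hle⟩ := hbs.hasse Λ hadm i hi s τ
    refine ⟨3 ^ τ.1 * z₀, ?_, ?_⟩
    · rw [eval_hasseDeriv_comp_third, ← mul_assoc, mul_comm (σ.den₀ (I + 1) s τ : ℚ), mul_assoc, hz₀]
      push_cast; ring
    · rw [abs_mul, abs_pow, abs_of_pos (by norm_num : (0 : ℤ) < 3)]
      exact mul_le_mul_of_nonneg_left hle (pow_nonneg (by norm_num) _)
  have hD : 1 ≤ thirdDen σ I s τ := by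
    unfold thirdDen
    exact one_le_mul (one_le_mul (hfin.one_le_den₀ s τ) (Nat.one_le_pow _ _ (Int.natAbs_pos.mpr S.bθ_ne)))
      (MonomialDen.one_le_monDen _ S.toQ.all_ne _)
  have hden : ∀ r, ∃ z : ℤ, (thirdDen σ I s τ : ℚ) * S.thirdVec Λ.R Λ.u Λ.uθ Λ.B Λ.p τ s r = z := by
    intro r
    obtain ⟨z, hz, _⟩ := S.exists_int_clear_mul_thirdVec Λ.R Λ.u Λ.uθ Λ.B Λ.p hadm.u_le hadm.uθ_le τ s hR3
      hadm.dir_le hadm.p_le r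
    exact ⟨z, hz⟩
  have hM : 1 ≤ thirdM σ I s τ := le_max_left _ _
  have hcM : ∑ r, |(S.thirdVec Λ.R Λ.u Λ.uθ Λ.B Λ.p τ s r : ℝ)| ≤ thirdM σ I s τ := by
    refine (S.sum_abs_thirdVec_le Λ.R Λ.u Λ.uθ Λ.B Λ.p hadm.u_le hadm.uθ_le τ s (hfin.one_le_den₀ s τ)
      hR3 hadm.dir_le hadm.p_le).trans (le_trans ?_ (le_max_right _ _))
    have hcard : (Λ.B.card : ℝ) ≤ σ.cardB I := by exact_mod_cast hadm.card_le
    have hP0 : (0 : ℝ) ≤ σ.P := by exact_mod_cast (abs_nonneg _).trans (hadm.p_le i hi)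
    have hM0 : (0 : ℝ) ≤ σ.M₀ (I + 1) s τ := by
      obtain ⟨z₀, _, hle⟩ := hbs.hasse Λ hadm i hi s τ
      exact_mod_cast (abs_nonneg _).trans hle
    have hXb : (0 : ℝ) ≤ (σ.Xb I : ℝ) ^ (∑ j, τ.2 j) := by
      rcases Nat.eq_zero_or_pos (∑ j, τ.2 j) with h0 | hpos
      · rw [h0, pow_zero]; exact zero_le_one
      · obtain ⟨j, -, hj⟩ := Finset.exists_ne_zero_of_sum_ne_zero (by omega : ∑ j, τ.2 j ≠ 0)
        have : (0 : ℤ) ≤ σ.Xb I := (abs_nonneg _).trans (hadm.dir_le i hi j)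
        exact pow_nonneg (by exact_mod_cast this) _
    have hbr : (0 : ℝ) ≤ (3 : ℝ) ^ τ.1 * σ.M₀ (I + 1) s τ * (σ.Xb I : ℝ) ^ (∑ j, τ.2 j) *
        ((MonomialDen.monDen S.toQ.all (S.thirdBox (σ.Dbox I) (σ.Dθ I) s) : ℝ)) ^ 2 := by positivity
    have key := mul_le_mul_of_nonneg_right (mul_le_mul_of_nonneg_right hcard hP0) hbr
    push_cast at key ⊢
    linarith [key]
  have hzero : ∀ x : ℤ, |x| ≤ (σ.Nfin I : ℤ) → ∀ τ'' : Tau S.d, tauNorm τ'' < σ.Tfin I →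
      S.g3φ Λ.R Λ.u Λ.uθ Λ.B Λ.p τ'' x = 0 := fun x hx τ'' hτ'' => hvan x hx trivial τ'' hτ''
  have hT0 := hfin.T0_succ_le
  have hτ' : tauNorm τ + (σ.Tfin I - σ.T0 (I + 1)) ≤ σ.Tfin I := by omega
  exact S.thirdVec_eq_zero_of_zeros Λ.R Λ.u Λ.uθ hK Λ.B Λ.p Λ.i₀ hadm.slab hfin.tthird_pos hBw0 hadm.wt
    hzero s τ hτ' hD hden hM hcM (hfin.hfinal s hs h3 τ hτ)

/-! ### Admissibility of the base-relative re-indexed family -/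

/-- **The base-relative re-indexed class of an unknown with a nonzero coefficient is admissible at level
`I + 1`.** [cite: Yu2013, Lemma 5.4 and (5.1)(i); shape only] -/
theorem adm_reindex3R {I : ℕ} (hfin : ThirdFinalTwoR σ I) (hbs : BasisStepTwoR σ Sh I)
    {Λ : S.G3Fam ι} (hadm : S.G3Adm σ Sh I Λ) {i₁ : ι} (hi₁ : i₁ ∈ Λ.B) (hp₁ : Λ.p i₁ ≠ 0) :
    S.G3Adm σ Sh (I + 1) (Λ.reindex3R i₁) := by
  set Λ' := Λ.reindex3R i₁ with hΛ'
  have hsub : ∀ i ∈ Λ'.B, i ∈ Λ.B := fun i hi => Λ.reindex3R_B_subset i₁ hi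
  have hi₁' : i₁ ∈ Λ'.B := Λ.base_mem_reindex3R i₁ hi₁
  have hq1 : (C (3⁻¹ : ℚ) * X).natDegree = 1 := natDegree_C_mul_X _ (by norm_num)
  have hdeg : ∀ i, (Λ'.R i).natDegree = (Λ.R i).natDegree := by
    intro i
    change ((Λ.R i).comp (C (3⁻¹ : ℚ) * X)).natDegree = _
    rw [natDegree_comp, hq1, mul_one]
  exact
    { card_le := (Finset.card_le_card (Λ.reindex3R_B_subset i₁)).trans (hadm.card_le.trans hfin.cardB_mono)
      exists_ne := ⟨i₁, hi₁', hp₁⟩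
      deg_ne := by
        intro i hi i' hi' hκ hne
        rw [hdeg, hdeg]
        refine hadm.deg_ne i (hsub i hi) i' (hsub i' hi') ?_ hne
        funext k
        have hk := congrFun hκ k
        unfold allκ at hk ⊢
        rw [Λ.snoc_eq_of_memR i₁ hi k, Λ.snoc_eq_of_memR i₁ hi' k]
        change (Fin.snoc (Λ'.u i) (Λ'.uθ i) : Fin (S.d + 1) → ℤ) k =
          (Fin.snoc (Λ'.u i') (Λ'.uθ i') : Fin (S.d + 1) → ℤ) k at hk
        rw [hk]
      R_ne := by
        intro i hi h0
        have hlc := leadingCoeff_comp (p := Λ.R i) (q := C (3⁻¹ : ℚ) * X) (by rw [hq1]; exact one_ne_zero)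
        change (Λ.R i).comp (C (3⁻¹ : ℚ) * X) = 0 at h0
        rw [h0, leadingCoeff_zero, leadingCoeff_C_mul_X] at hlc
        exact (mul_ne_zero (leadingCoeff_ne_zero.mpr (hadm.R_ne i (hsub i hi))) (pow_ne_zero _ (by norm_num)))
          hlc.symm
      deg_le := fun i hi => (hdeg i).le.trans (hadm.deg_le i (hsub i hi))
      p_le := fun i hi => hadm.p_le i (hsub i hi)
      u_le := fun i hi => (hbs.box Λ hadm i₁ hi₁ i hi).1
      uθ_le := fun i hi => (hbs.box Λ hadm i₁ hi₁ i hi).2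
      dir_le := fun i hi j =>
        (S.abs_dirScalar_le (hbs.box Λ hadm i₁ hi₁ i hi).1 (hbs.box Λ hadm i₁ hi₁ i hi).2 j).trans
          (hfin.Xb_succ j)
      slab := by
        intro i hi
        have hfun : ∀ i ∈ Λ'.B, Λ.u i = (fun j => 3 * Λ'.u i j + Λ.u i₁ j) ∧
            Λ.uθ i = 3 * Λ'.uθ i + Λ.uθ i₁ :=
          fun i hi => ⟨funext fun j => Λ.u_eq_of_memR i₁ hi j, Λ.uθ_eq_of_memR i₁ hi⟩
        have hz : ∀ i ∈ Λ'.B, S.zexpo (Λ.u i) (Λ.uθ i) =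
            3 * S.zexpo (Λ'.u i) (Λ'.uθ i) + S.zexpo (Λ.u i₁) (Λ.uθ i₁) := by
          intro i hi
          conv_lhs => rw [(hfun i hi).1, (hfun i hi).2]
          rw [S.zexpo_reindex3]
        have h0 : S.zexpo (Λ'.u i₁) (Λ'.uθ i₁) = 0 := by
          have hu0 : Λ'.u i₁ = fun _ => 0 := funext fun j => by
            change (Λ.u i₁ j - Λ.u i₁ j) / 3 = 0; simp
          have hθ0 : Λ'.uθ i₁ = 0 := by change (Λ.uθ i₁ - Λ.uθ i₁) / 3 = 0; simp
          rw [hu0, hθ0]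
          unfold zexpo zγ
          simp
        have e : S.δexpo Λ'.u Λ'.uθ i₁ i =
            (3 : ℚ_[2])⁻¹ * (S.δexpo Λ.u Λ.uθ Λ.i₀ i - S.δexpo Λ.u Λ.uθ Λ.i₀ i₁) := by
          unfold δexpo
          rw [hz i hi, hz i₁ hi₁', h0]
          field_simp
          ring
        change ‖S.δexpo Λ'.u Λ'.uθ i₁ i‖ ≤ _
        rw [e, norm_mul, norm_inv, norm_three_two, inv_one, one_mul, sub_eq_add_neg]
        exact (IsUltrametricDist.norm_add_le_max _ _).trans
          (max_le (hadm.slab i (hsub i hi)) (by rw [norm_neg]; exact hadm.slab i₁ hi₁))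
      wt := by
        intro i hi t₀ k
        change ‖(hw (fun i => (Λ.R i).comp (C (3⁻¹ : ℚ) * X)) i t₀).coeff k‖ * _ ≤ _
        rw [norm_coeff_hw_comp_third]
        exact (hadm.wt i (hsub i hi) t₀ k).trans hfin.Bw_mono
      hasse := fun i hi x τ => hbs.hasse Λ hadm i (hsub i hi) x τ
      shape := hbs.shape Λ hadm i₁ hi₁ }

/-! ### The third step (v2) -/

/-- **THE THIRD STEP OF THE LEVEL INDUCTION (v2, base-relative re-indexing)**: `ThirdStepTwo σ Sh I` from
`ThirdFinalTwoR σ I`, `BasisStepTwoR σ Sh I` and the `3`-Kummer condition on `(α, θ)`.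
[cite: Yu2013, Lemmas 5.3–5.4] [cite: Nesterenko2003, §4.3] -/
theorem thirdStepTwo_ofR {I : ℕ} (hfin : ThirdFinalTwoR σ I) (hbs : BasisStepTwoR σ Sh I)
    (hK : ∀ κ : Fin (S.d + 1) → ℕ, (∃ j, ¬ 3 ∣ κ j) → ∀ γ : ℚ, ∏ j, S.toQ.all j ^ κ j ≠ γ ^ 3) :
    ThirdStepTwo σ Sh I := by
  intro Λ hadm hvan
  obtain ⟨i₁, hi₁, hp₁⟩ := hadm.exists_ne
  refine ⟨Λ.reindex3R i₁, adm_reindex3R σ Sh hfin hbs hadm hi₁ hp₁, ?_⟩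
  exact S.vanish_cop_reindex3R Λ (thirdVec_eq_zero_of_admR σ Sh hfin hbs hK hadm hvan) i₁

end TwoSetup

end Summit.ABC.StewartYu

end
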